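import Literature.MathematicalPhysics.QuantumFieldTheory.Balaban1983to89.T4AxialGaugeSmallField
import Literature.MathematicalPhysics.QuantumFieldTheory.Balaban1983to89.B15ShellGauge193
import Literature.MathematicalPhysics.QuantumFieldTheory.Balaban1983to89.TorusReflectionPositivity
import HarnessLib

/-!
# The axial-gauge (comb) bond variable is a conjugated LADDER = a product of conjugated THIN RECTANGLES of the host torus

Cell `ym3-torus` (HUMAN RULING D-0037, rung R3), width seat `ym3-torus-px5` gen 10; FILE 4 of the (THIN-RECT) lane (the «ladder
dictionary» row of `stub_thinRect`, LINE 28 v3 draft, w2-19936 g15).  Pure group algebra on the word machinery of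
`B7Prop1Explicit` (`hol`, `seg`, `ladder`, `treeWord`) and the torus dictionary of `T4AxialGaugeSmallField` (`castSite`, `pull`,
`axialGauge`), read against the host tree's `lineHolonomy` / `rectangleHolonomy` of `toConfig U` (`TorusReflectionPositivity` §1):

* §1 (`ℤ^d`, `GaugeGroup`) with lit ✓`B15ShellGauge193.hol_ladder_append` / `dist1_ladder_append_le` (the ladder over a
  concatenation `w₁ ++ w₂` splits as `hol(w₁)·ladder(w₂)@(x + disp w₁)·hol(w₁)⁻¹ · ladder(w₁)@x`, the shared rung cancels;
  `dist1 ≤ dist1(ladder w₂) + dist1(ladder w₁)`) BY NAME: `dist1_axial_bond_eq` — in the axial gauge rooted at `y`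
  the bond `(x, x + e_μ)` has `dist1 = dist1 (hol V w (ladder Q μ))`, `Q = treeWord (lowPart μ (x − y))`, `w = x − lowPart μ (x − y)`
  (lit ✓`B8Lemma1NonAbelian.axial_bond_eq_sharp` + conjugation invariance of `dist1`).
* §2 (torus) `hol_pull_seg`, `hol_pull_ladder_seg`: the pulled-back holonomy of a straight segment / of the ladder over a straight segment
  IS the host `lineHolonomy` / the THIN RECTANGLE `rectangleHolonomy (toConfig U) (castSite z) κ μ n 1`.
* §3 `dist1_gaugeAct_axialGauge_le_of_treeWord_eq_seg` / `…_eq_seg_append_seg`: for a bond `⟨castSite x, μ⟩` of a non-wrapping box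
  `[lo, hi]` whose comb word `treeWord (lowPart μ (x − lo))` is ONE straight segment (resp. TWO), the dressed bond variable
  `(U^{axialGauge U lo hi}) b` has `dist1 ≤ dist1(R)` (resp. `≤ dist1(R_A) + dist1(R_B)`) for explicit thin rectangles of `toConfig U`
  with the bond's direction `μ` as their width-one side.  (In `d = 3` every off-tree bond is one of these two cases; the
  `T3Family` specialisation is FILE 5.)

Everything here is proved; no definitions; no measure theory.
-/

namespace Summit.QuantumFields.YangMills.Theorems.UnitScaleGibbsAxialBondLadderDictionary

open Literature.MathematicalPhysics.QuantumFieldTheory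
open Literature.MathematicalPhysics.QuantumFieldTheory.Balaban1983to89
open Literature.MathematicalPhysics.QuantumFieldTheory.Balaban1983to89.B7Prop1Explicit (Letter e e_apply disp disp_nil
  disp_cons disp_append disp_seg disp_revWord hol hol_nil hol_cons hol_append hol_ladder stepHol stepHol_true stepHol_false
  gaugeAct hol_gaugeAct_closed seg seg_natCast revWord ladder treeWord axialFn)
open Literature.MathematicalPhysics.QuantumFieldTheory.Balaban1983to89.B8Lemma1NonAbelian (lowPart lowPart_apply e_nonneg
  axial_bond_eq_sharp axial_treeBond_eq_one)
open Literature.MathematicalPhysics.QuantumFieldTheory.Balaban1983to89.T4AxialGaugeSmallField (castSite castSite_apply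
  castSite_add_e pull pull_apply boxBonds axialGauge gaugeAct_axialGauge_castSite gaugeAct_axialGauge_eq_one)
open Literature.MathematicalPhysics.QuantumFieldTheory.Balaban1983to89.B11GaugeGlue (dist1_conj_inv)
open Literature.MathematicalPhysics.QuantumFieldTheory.Balaban1983to89.B15ShellGauge193 (hol_ladder_append dist1_ladder_append_le)

noncomputable section

/-! ## §1 Group level on `ℤ^d`: ladders over concatenated words -/

section GroupLevel

variable {d : ℕ} {G : Type*} [GaugeGroup G]

/-- **The dressed bond is a conjugated ladder, read by `dist1`**: in the axial gauge rooted at `y`,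
`dist1 (V^{axial}(x, x + e_μ)) = dist1 (V(ladder Q μ)@w)` with `Q = treeWord (lowPart μ (x − y))`, `w = x − lowPart μ (x − y)`
(lit ✓`axial_bond_eq_sharp`: the bond is the conjugate by `V^{axial}(Q)@w` of `V^{axial}(ladder Q μ)@w`, and a closed word transforms by
conjugation under a gauge transformation). [cite: Balaban1985Averaging, pp.24–25] -/
theorem dist1_axial_bond_eq (V : (Fin d → ℤ) → Fin d → G) (y x : Fin d → ℤ) (μ : Fin d) :
    dist1 (gaugeAct (axialFn V y) V x μ) =
      dist1 (hol V (x - lowPart μ (x - y)) (ladder (treeWord (lowPart μ (x - y))) μ)) := by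
  have hdisp : disp (ladder (treeWord (lowPart μ (x - y))) μ) = 0 := by
    simp only [ladder, disp_append, disp_cons, disp_nil, disp_revWord, B7Prop1Explicit.Letter.vec_true,
      B7Prop1Explicit.Letter.vec_false]
    abel
  rw [axial_bond_eq_sharp, dist1_conj_inv, hol_gaugeAct_closed _ _ _ _ hdisp, GaugeGroup.dist1_conj]

end GroupLevel

/-! ## §2 Torus dictionary: segments are lines, ladders over segments are thin rectangles -/

section Torus

variable {P : Params} {j : ℕ} {G : Type*}

/-- `castSite (z + n·e_κ) = castSite z + n·e_κ` on the torus. [folklore] -/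
theorem castSite_add_zsmul_e (z : Fin P.d → ℤ) (κ : Fin P.d) (n : ℤ) :
    (castSite (z + n • e κ) : Site P j) =
      @HAdd.hAdd (Literature.MathematicalPhysics.QuantumFieldTheory.Site P.d (P.sitesPerDir j))
        (Literature.MathematicalPhysics.QuantumFieldTheory.Site P.d (P.sitesPerDir j))
        (Literature.MathematicalPhysics.QuantumFieldTheory.Site P.d (P.sitesPerDir j)) instHAdd
        (castSite z) (Pi.single κ (n : ZMod (P.sitesPerDir j))) := by
  funext ι
  by_cases h : ι = κ
  · subst h; simp [castSite_apply, e_apply]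
  · simp [castSite_apply, e_apply, h]

/-- `castSite (z + e_μ) = castSite z + e_μ` (additive form of `castSite_add_e`, read in the host tree's site type). [folklore] -/
theorem castSite_add_e' (z : Fin P.d → ℤ) (μ : Fin P.d) :
    (castSite (z + e μ) : Site P j) =
      @HAdd.hAdd (Literature.MathematicalPhysics.QuantumFieldTheory.Site P.d (P.sitesPerDir j))
        (Literature.MathematicalPhysics.QuantumFieldTheory.Site P.d (P.sitesPerDir j))
        (Literature.MathematicalPhysics.QuantumFieldTheory.Site P.d (P.sitesPerDir j)) instHAdd
        (castSite z) (Pi.single μ (1 : ZMod (P.sitesPerDir j))) := by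
  rw [castSite_add_e, shift_eq_shift]; rfl

variable [Group G]

/-- SEGMENT DICTIONARY: the pulled-back holonomy of `n` forward steps in direction `κ` is the host straight-line holonomy
`lineHolonomy (toConfig U) κ n (castSite z)`. [folklore] -/
theorem hol_pull_seg (U : GaugeField P j G) (κ : Fin P.d) :
    ∀ (n : ℕ) (z : Fin P.d → ℤ), hol (pull U) z (seg κ (n : ℤ)) = lineHolonomy (toConfig U) κ n (castSite z)
  | 0, z => by simp [lineHolonomy]
  | n + 1, z => by
    rw [show ((n + 1 : ℕ) : ℤ) = ((n + 1 : ℕ) : ℤ) from rfl, seg_natCast, List.replicate_succ, hol_cons, stepHol_true,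
      B7Prop1Explicit.Letter.vec_true, ← seg_natCast, hol_pull_seg U κ n (z + e κ), lineHolonomy, castSite_add_e,
      shift_eq_shift]
    rfl

/-- LADDER-OVER-A-SEGMENT DICTIONARY: `V(ladder (seg κ n) μ)@z` of the pullback is the host THIN RECTANGLE holonomy
`rectangleHolonomy (toConfig U) (castSite z) κ μ n 1` (`n` steps along `κ`, width one along `μ`). [folklore] -/
theorem hol_pull_ladder_seg (U : GaugeField P j G) (z : Fin P.d → ℤ) (κ μ : Fin P.d) (n : ℕ) :
    hol (pull U) z (ladder (seg κ (n : ℤ)) μ) = rectangleHolonomy (toConfig U) (castSite z) κ μ n 1 := by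
  rw [hol_ladder, hol_pull_seg, hol_pull_seg, disp_seg, pull_apply, pull_apply, castSite_add_zsmul_e, castSite_add_e',
    rectangleHolonomy]
  simp only [lineHolonomy, mul_one, Int.cast_natCast, Nat.cast_one, toConfig_apply]

variable {G' : Type*} [GaugeGroup G']

/-- **ONE-SEGMENT COMB WORD ⟹ ONE THIN RECTANGLE.**  On a non-wrapping box `[lo, hi]` (`hi κ − lo κ < sitesPerDir j`), for a box bond
`⟨castSite x, μ⟩` (`lo ≤ x`, `x + e_μ ≤ hi`) whose comb word is a single straight segment, `treeWord (lowPart μ (x − lo)) = seg κ n`,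
the axial-gauge bond variable satisfies `dist1 ((U^{axialGauge U lo hi}) b) ≤ dist1 (rect_{(κ,μ)}(n × 1)@castSite(x − lowPart μ (x − lo)))`
(in fact `=`). [cite: Balaban1985Averaging, pp.24–25] -/
theorem dist1_gaugeAct_axialGauge_le_of_treeWord_eq_seg (U : GaugeField P j G') {lo hi : Fin P.d → ℤ}
    (hN : ∀ κ, hi κ - lo κ < P.sitesPerDir j) {x : Fin P.d → ℤ} {μ : Fin P.d} (hx : lo ≤ x) (hxμ : x + e μ ≤ hi)
    {κ : Fin P.d} {n : ℕ} (hQ : treeWord (lowPart μ (x - lo)) = seg κ (n : ℤ)) :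
    dist1 (GaugeField.gaugeAct (axialGauge U lo hi) U ⟨castSite x, μ⟩) ≤
      dist1 (rectangleHolonomy (toConfig U) (castSite (x - lowPart μ (x - lo)) : Site P j) κ μ n 1) := by
  rw [gaugeAct_axialGauge_castSite U hN hx hxμ, dist1_axial_bond_eq, hQ, hol_pull_ladder_seg]

/-- **TWO-SEGMENT COMB WORD ⟹ TWO THIN RECTANGLES.**  Same setting, comb word `treeWord (lowPart μ (x − lo)) = seg κ₁ n₁ ++ seg κ₀ n₀`
(the L-shaped ladder): `dist1 ((U^{axialGauge U lo hi}) b) ≤ dist1 (rect_{(κ₀,μ)}(n₀ × 1)@castSite(w + n₁e_{κ₁})) + dist1 (rect_{(κ₁,μ)}(n₁ × 1)@castSite w)`,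
`w = x − lowPart μ (x − lo)` (one transport: `hol_ladder_append`). [cite: Balaban1985Averaging, pp.24–25] -/
theorem dist1_gaugeAct_axialGauge_le_of_treeWord_eq_seg_append_seg (U : GaugeField P j G') {lo hi : Fin P.d → ℤ}
    (hN : ∀ κ, hi κ - lo κ < P.sitesPerDir j) {x : Fin P.d → ℤ} {μ : Fin P.d} (hx : lo ≤ x) (hxμ : x + e μ ≤ hi)
    {κ₁ κ₀ : Fin P.d} {n₁ n₀ : ℕ} (hQ : treeWord (lowPart μ (x - lo)) = seg κ₁ (n₁ : ℤ) ++ seg κ₀ (n₀ : ℤ)) :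
    dist1 (GaugeField.gaugeAct (axialGauge U lo hi) U ⟨castSite x, μ⟩) ≤
      dist1 (rectangleHolonomy (toConfig U) (castSite (x - lowPart μ (x - lo) + (n₁ : ℤ) • e κ₁) : Site P j) κ₀ μ n₀ 1) +
      dist1 (rectangleHolonomy (toConfig U) (castSite (x - lowPart μ (x - lo)) : Site P j) κ₁ μ n₁ 1) := by
  rw [gaugeAct_axialGauge_castSite U hN hx hxμ, dist1_axial_bond_eq, hQ]
  refine (dist1_ladder_append_le _ _ _ _ _).trans (le_of_eq ?_)
  rw [disp_seg, hol_pull_ladder_seg, hol_pull_ladder_seg]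

/-- Squared form of the two-rectangle bound: `dist1² ≤ 2·dist1(R_A)² + 2·dist1(R_B)²`. [folklore] -/
theorem dist1_sq_gaugeAct_axialGauge_le_of_treeWord_eq_seg_append_seg (U : GaugeField P j G') {lo hi : Fin P.d → ℤ}
    (hN : ∀ κ, hi κ - lo κ < P.sitesPerDir j) {x : Fin P.d → ℤ} {μ : Fin P.d} (hx : lo ≤ x) (hxμ : x + e μ ≤ hi)
    {κ₁ κ₀ : Fin P.d} {n₁ n₀ : ℕ} (hQ : treeWord (lowPart μ (x - lo)) = seg κ₁ (n₁ : ℤ) ++ seg κ₀ (n₀ : ℤ)) :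
    dist1 (GaugeField.gaugeAct (axialGauge U lo hi) U ⟨castSite x, μ⟩) ^ 2 ≤
      2 * dist1 (rectangleHolonomy (toConfig U) (castSite (x - lowPart μ (x - lo) + (n₁ : ℤ) • e κ₁) : Site P j) κ₀ μ n₀ 1) ^ 2 +
      2 * dist1 (rectangleHolonomy (toConfig U) (castSite (x - lowPart μ (x - lo)) : Site P j) κ₁ μ n₁ 1) ^ 2 := by
  have h := dist1_gaugeAct_axialGauge_le_of_treeWord_eq_seg_append_seg U hN hx hxμ hQ
  have h0 : 0 ≤ dist1 (GaugeField.gaugeAct (axialGauge U lo hi) U ⟨castSite x, μ⟩) := GaugeGroup.dist1_nonneg _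
  nlinarith [GaugeGroup.dist1_nonneg (rectangleHolonomy (toConfig U) (castSite (x - lowPart μ (x - lo) + (n₁ : ℤ) • e κ₁) : Site P j) κ₀ μ n₀ 1),
    GaugeGroup.dist1_nonneg (rectangleHolonomy (toConfig U) (castSite (x - lowPart μ (x - lo)) : Site P j) κ₁ μ n₁ 1),
    sq_nonneg (dist1 (rectangleHolonomy (toConfig U) (castSite (x - lowPart μ (x - lo) + (n₁ : ℤ) • e κ₁) : Site P j) κ₀ μ n₀ 1) -
      dist1 (rectangleHolonomy (toConfig U) (castSite (x - lowPart μ (x - lo)) : Site P j) κ₁ μ n₁ 1))]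

/-- Tree bonds (comb word empty, `lowPart μ (x − lo) = 0`) are exactly `1`: `dist1 = 0`. [cite: Balaban1985Averaging, p.24] -/
theorem dist1_gaugeAct_axialGauge_eq_zero_of_lowPart_eq_zero (U : GaugeField P j G') {lo hi : Fin P.d → ℤ}
    (hN : ∀ κ, hi κ - lo κ < P.sitesPerDir j) {x : Fin P.d → ℤ} {μ : Fin P.d} (hx : lo ≤ x) (hxμ : x + e μ ≤ hi)
    (h0 : lowPart μ (x - lo) = 0) :
    dist1 (GaugeField.gaugeAct (axialGauge U lo hi) U ⟨castSite x, μ⟩) = 0 := by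
  rw [gaugeAct_axialGauge_eq_one U hN hx hxμ h0, GaugeGroup.dist1_one]

end Torus

end

end Summit.QuantumFields.YangMills.Theorems.UnitScaleGibbsAxialBondLadderDictionary
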